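import Literature.Barriers.ResolutionOfSingularities.ResidualOrderUnboundedBounds
import HarnessLib

/-!
# Hauser–Perlega's first example (characteristic 2): the stages of one cycle

`Literature/Barriers/ResolutionOfSingularities/ResidualOrderUnboundedExample1.lean` — the seven
blow-up stages (1)–(7) of the FIRST EXAMPLE of Hauser–Perlega [cite: HauserPerlega2019, §4]
("Field of characteristic `p = 2`, `n = 5`, `ord f = 8`", variables `x, y, u, v, w` = indices
`0, 1, 2, 3, 4`), each as a theorem `Shape_before F → Shape_after (blowupStep 8 j t F)` over any
commutative ring of characteristic `2`.

## The printed cycle (TeX source of arXiv:1802.05010v1, §4; note the macro `\y = u`)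

(0) `F = x^{8a+4} y^{8b+4} u^{8r} w^{8s−d}·(w^d(λ + u^{2d+6}Q) + x^{d+1}u^{2d+6}A)`, residual order `d`
(`d` even, `A, B` units, `Q` arbitrary, `λ ≠ 0`);
(1) `x`-chart, `y ↦ y+1`, `u ↦ u+1`, cleaning: `x^{8a} w^{8s−d}(w^d y^4 B + w^d x^{2d+6} Q + x^{2d+7} A)`;
(2) `x`-chart: `x^{8a+4} w^{8s−d}(w^d y^4 B + x^{d+3} A)`;
(3) `u`-chart: `x^{8a+4} u^{8r+7} w^{8s−d}(w^d y^4 u B + x^{d+3} A)`;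
(4) `d/2` times `v`-chart: `… v^{(8a+8r+8s+6)d/2} …(w^d y^4 u v^d B + x^{d+3} A)`;
(5) `w`-chart, `y ↦ y+1`, `v ↦ v+1`: `x^{8a+4} u^{8r+7} w^{8s−(d+2)}(w^{d+2} u B + x^{d+3} A)`;
(6) `u`-chart: `x^{8a+4} u^{8r+4} w^{8s−(d+2)}(w^{d+2} B + x^{d+3} A)`;
(7) `2d+10` times `y`-chart: `x^{8a+4} y^{8b} u^{8r+4} w^{8s−(d+2)}(w^{d+2}(λ + y^{2d+10}Q) + x^{d+3}y^{2d+10}A)`,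
"again the same form as the starting equation (exchanging `y` with `u` and `b` with `r`), with the
exception of `d` being raised to `d + 2`".

## Lean rendering

A shape `ShapeN d …` records (i) a REGION containing the support of `F` — a finite union of
translated orthants `M + c + ℕ⁵` and exact points, transcribing the displayed formula with
`A, B, Q` arbitrary (e.g. `x^{d+3}A·M` ↦ the orthant `{e ≥ M + (d+3,0,0,0,0)}`), the exceptional
monomial `M = (ex, ey, eu, ev, ew)` being given by raw exponents with their residues mod `8`
(`8a+4 ↦ ex ≡ 4`, `8s − d ↦ ew` with `ew + d ≡ 0`, …) — and (ii) the non-vanishing of the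
coefficients of the KEY monomials (`λ·M w^d`, the constant terms of the units `A`, `B`).
The passage from a stage to the next is `blowupStep` (`ResidualOrderUnboundedBlowup.lean`);
orders and residual orders are read off the shapes in `ResidualOrderUnboundedExample1Cycle.lean`.
-/

noncomputable section

open MvPolynomial Finset

open scoped BigOperators

namespace Literature.Barriers.ResolutionOfSingularities

open Literature.AlgebraicGeometry.Resolution.Hauser2010

namespace HauserPerlega

/-! ## Exponent vectors in the five variables `x, y, u, v, w` -/

section Exp5

/-- The exponent vector `(a, b, c, d, e)` of `xᵃ yᵇ uᶜ vᵈ wᵉ`. [folklore] -/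
def V (a b c d e : ℕ) : Fin 5 →₀ ℕ :=
  Finsupp.equivFunOnFinite.symm ![a, b, c, d, e]

/-- `x`-exponent of `V a b c d e`. [folklore] -/
@[simp] theorem V_apply_zero (a b c d e : ℕ) : V a b c d e 0 = a := rfl
/-- `y`-exponent of `V a b c d e`. [folklore] -/
@[simp] theorem V_apply_one (a b c d e : ℕ) : V a b c d e 1 = b := rfl
/-- `u`-exponent of `V a b c d e`. [folklore] -/
@[simp] theorem V_apply_two (a b c d e : ℕ) : V a b c d e 2 = c := rfl
/-- `v`-exponent of `V a b c d e`. [folklore] -/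
@[simp] theorem V_apply_three (a b c d e : ℕ) : V a b c d e 3 = d := rfl
/-- `w`-exponent of `V a b c d e`. [folklore] -/
@[simp] theorem V_apply_four (a b c d e : ℕ) : V a b c d e 4 = e := rfl

/-- `∀` over `Fin 5`. [folklore] -/
theorem forall_fin5 {P : Fin 5 → Prop} : (∀ i, P i) ↔ P 0 ∧ P 1 ∧ P 2 ∧ P 3 ∧ P 4 := by
  constructor
  · intro h; exact ⟨h 0, h 1, h 2, h 3, h 4⟩
  · rintro ⟨h0, h1, h2, h3, h4⟩ i
    fin_cases i <;> assumption

/-- Equality of exponent vectors is coordinatewise. [folklore] -/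
theorem eq_V_iff (f : Fin 5 →₀ ℕ) (a b c d e : ℕ) :
    f = V a b c d e ↔ f 0 = a ∧ f 1 = b ∧ f 2 = c ∧ f 3 = d ∧ f 4 = e := by
  rw [Finsupp.ext_iff, forall_fin5]
  simp

/-- Every exponent vector is a `V`. [folklore] -/
theorem eq_V (f : Fin 5 →₀ ℕ) : f = V (f 0) (f 1) (f 2) (f 3) (f 4) := by
  rw [eq_V_iff]; simp

/-- The degree in coordinates. [folklore] -/
theorem degree_fin5 (f : Fin 5 →₀ ℕ) : f.degree = f 0 + f 1 + f 2 + f 3 + f 4 := by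
  rw [Finsupp.degree_eq_sum, Fin.sum_univ_five]

/-- Total degree of `V a b c d e`. [folklore] -/
@[simp] theorem degree_V (a b c d e : ℕ) : (V a b c d e).degree = a + b + c + d + e := by
  rw [degree_fin5]; rfl

/-- `q`-th power exponents in coordinates. [folklore] -/
theorem isPthPowerExponent_fin5_iff (q : ℕ) (f : Fin 5 →₀ ℕ) :
    IsPthPowerExponent q f ↔ q ∣ f 0 ∧ q ∣ f 1 ∧ q ∣ f 2 ∧ q ∣ f 3 ∧ q ∣ f 4 := by
  rw [isPthPowerExponent_iff, forall_fin5]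

/-- Pointwise order in coordinates. [folklore] -/
theorem V_le_iff (a b c d e : ℕ) (f : Fin 5 →₀ ℕ) :
    V a b c d e ≤ f ↔ a ≤ f 0 ∧ b ≤ f 1 ∧ c ≤ f 2 ∧ d ≤ f 3 ∧ e ≤ f 4 := by
  rw [Finsupp.le_def, forall_fin5]
  simp

/-- Sum of exponent vectors in coordinates. [folklore] -/
@[simp] theorem V_add_V (a b c d e a' b' c' d' e' : ℕ) :
    V a b c d e + V a' b' c' d' e' = V (a + a') (b + b') (c + c') (d + d') (e + e') := by
  rw [eq_V_iff]; simp

end Exp5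

/-! ## The charts of the first example and their `Produces` / `base` -/

section Charts

variable {K : Type*} [CommRing K]

/-- Translation vector of a chart: `tᵢ = 1` on `T`, `0` elsewhere. [cite: HauserPerlega2019, §2] -/
def tOf (T : Finset (Fin 5)) : Fin 5 → K := fun i => if i ∈ T then 1 else 0

/-- Off `T` the translation is `0`. [folklore] -/
theorem tOf_of_not_mem {T : Finset (Fin 5)} {i : Fin 5} (hi : i ∉ T) : (tOf T i : K) = 0 := by
  simp [tOf, hi]

/-- The hypothesis `ht` of the toolkit for the chart `(j, T)`: `tᵢ = 0` off `T`. [folklore] -/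
theorem tOf_hyp (T : Finset (Fin 5)) (j : Fin 5) :
    ∀ i, i ∉ T → i ≠ j → (tOf T i : K) = 0 := fun _ hi _ => tOf_of_not_mem hi

/-- On `T` the translation is `1`, so `∏_{i∈T} tᵢ^{nᵢ} = 1` (the factor of `coeff_base_blowupStep`). [folklore] -/
theorem prod_tOf_pow (T : Finset (Fin 5)) (n : Fin 5 → ℕ) :
    ∏ i ∈ T, (tOf T i : K) ^ (n i) = 1 :=
  Finset.prod_eq_one fun i hi => by simp [tOf, hi]

/-- `Produces` for a monomial chart (no translation) in coordinates: `x`-chart. [folklore] -/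
theorem produces_x_iff (e e' : Fin 5 →₀ ℕ) : Produces 8 0 ∅ e e' ↔
    e.degree = e' 0 + 8 ∧ e' 1 = e 1 ∧ e' 2 = e 2 ∧ e' 3 = e 3 ∧ e' 4 = e 4 := by
  simp [Produces, forall_fin5]

/-- `base` for the `x`-chart in coordinates. [folklore] -/
theorem base_x (e : Fin 5 →₀ ℕ) : base 8 0 ∅ e = V (e.degree - 8) (e 1) (e 2) (e 3) (e 4) := by
  rw [eq_V_iff]; simp [base_apply]

/-- `x`-chart with `y ↦ y + 1`, `u ↦ u + 1`. [folklore] -/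
theorem produces_xyu_iff (e e' : Fin 5 →₀ ℕ) : Produces 8 0 {1, 2} e e' ↔
    e.degree = e' 0 + 8 ∧ e' 3 = e 3 ∧ e' 4 = e 4 := by
  simp [Produces, forall_fin5]

/-- `base` for the `x`-chart with `y, u` translated, in coordinates. [folklore] -/
theorem base_xyu (e : Fin 5 →₀ ℕ) : base 8 0 {1, 2} e = V (e.degree - 8) 0 0 (e 3) (e 4) := by
  rw [eq_V_iff]; simp [base_apply]

/-- `y`-chart. [folklore] -/
theorem produces_y_iff (e e' : Fin 5 →₀ ℕ) : Produces 8 1 ∅ e e' ↔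
    e.degree = e' 1 + 8 ∧ e' 0 = e 0 ∧ e' 2 = e 2 ∧ e' 3 = e 3 ∧ e' 4 = e 4 := by
  simp [Produces, forall_fin5]

/-- `base` for the `y`-chart in coordinates. [folklore] -/
theorem base_y (e : Fin 5 →₀ ℕ) : base 8 1 ∅ e = V (e 0) (e.degree - 8) (e 2) (e 3) (e 4) := by
  rw [eq_V_iff]; simp [base_apply]

/-- `u`-chart. [folklore] -/
theorem produces_u_iff (e e' : Fin 5 →₀ ℕ) : Produces 8 2 ∅ e e' ↔
    e.degree = e' 2 + 8 ∧ e' 0 = e 0 ∧ e' 1 = e 1 ∧ e' 3 = e 3 ∧ e' 4 = e 4 := by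
  simp [Produces, forall_fin5]

/-- `base` for the `u`-chart in coordinates. [folklore] -/
theorem base_u (e : Fin 5 →₀ ℕ) : base 8 2 ∅ e = V (e 0) (e 1) (e.degree - 8) (e 3) (e 4) := by
  rw [eq_V_iff]; simp [base_apply]

/-- `v`-chart. [folklore] -/
theorem produces_v_iff (e e' : Fin 5 →₀ ℕ) : Produces 8 3 ∅ e e' ↔
    e.degree = e' 3 + 8 ∧ e' 0 = e 0 ∧ e' 1 = e 1 ∧ e' 2 = e 2 ∧ e' 4 = e 4 := by
  simp [Produces, forall_fin5]

/-- `base` for the `v`-chart in coordinates. [folklore] -/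
theorem base_v (e : Fin 5 →₀ ℕ) : base 8 3 ∅ e = V (e 0) (e 1) (e 2) (e.degree - 8) (e 4) := by
  rw [eq_V_iff]; simp [base_apply]

/-- `w`-chart with `y ↦ y + 1`, `v ↦ v + 1`. [folklore] -/
theorem produces_wyv_iff (e e' : Fin 5 →₀ ℕ) : Produces 8 4 {1, 3} e e' ↔
    e.degree = e' 4 + 8 ∧ e' 0 = e 0 ∧ e' 2 = e 2 := by
  simp [Produces, forall_fin5]

/-- `base` for the `w`-chart with `y, v` translated, in coordinates. [folklore] -/
theorem base_wyv (e : Fin 5 →₀ ℕ) : base 8 4 {1, 3} e = V (e 0) 0 (e 2) 0 (e.degree - 8) := by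
  rw [eq_V_iff]; simp [base_apply]

end Charts

/-! ## Stage (2): the `x`-chart, `S1 → S2` -/

section Stages

variable {K : Type*} [CommRing K]

/-- Shape after blow-up (1): `x^{ex} w^{ew}·(w^d y^4 B + w^d x^{2d+6} Q + x^{2d+7} A)`, `A, B` units
(`ex ↔ 8a`, `ew ↔ 8s − d`). [cite: HauserPerlega2019, §4 First example (1)] -/
def Shape1 (d ex ew : ℕ) (F : MvPolynomial (Fin 5) K) : Prop :=
  (∀ e ∈ F.support,
    (ex ≤ e 0 ∧ 4 ≤ e 1 ∧ ew + d ≤ e 4) ∨ (ex + 2 * d + 6 ≤ e 0 ∧ ew + d ≤ e 4) ∨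
      (ex + 2 * d + 7 ≤ e 0 ∧ ew ≤ e 4)) ∧
  coeff (V ex 4 0 0 (ew + d)) F ≠ 0 ∧ coeff (V (ex + 2 * d + 7) 0 0 0 ew) F ≠ 0

/-- Shape after blow-up (2): `x^{ex} w^{ew}·(w^d y^4 B + x^{d+3} A)` (`ex ↔ 8a+4`).
[cite: HauserPerlega2019, §4 First example (2)] -/
def Shape2 (d ex ew : ℕ) (F : MvPolynomial (Fin 5) K) : Prop :=
  (∀ e ∈ F.support, (ex ≤ e 0 ∧ 4 ≤ e 1 ∧ ew + d ≤ e 4) ∨ (ex + d + 3 ≤ e 0 ∧ ew ≤ e 4)) ∧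
  coeff (V ex 4 0 0 (ew + d)) F ≠ 0 ∧ coeff (V (ex + d + 3) 0 0 0 ew) F ≠ 0

/-- **Blow-up (2)**, `x`-chart: `S1(d, ex, ew) → S2(d, ex + ew + d − 4, ew)`; "The residual order
has decreased to `d + 3`". [cite: HauserPerlega2019, §4 First example (2)] -/
theorem shape2_of_shape1 {d ex ew : ℕ} (hd : 2 ≤ d) (hd2 : d % 2 = 0) (hex : 8 ≤ ex)
    (hex8 : ex % 8 = 0) (hew : (ew + d) % 8 = 0) {F : MvPolynomial (Fin 5) K}
    (hF : Shape1 d ex ew F) :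
    Shape2 d (ex + ew + d - 4) ew (blowupStep 8 0 (tOf ∅) F) := by
  obtain ⟨hR, hk1, hk2⟩ := hF
  have hq : ∀ e ∈ F.support, 8 ≤ e.degree := fun e he => by
    have h := hR e he; rw [degree_fin5]; omega
  have hj : (0 : Fin 5) ∉ (∅ : Finset (Fin 5)) := by simp
  refine ⟨?_, ?_, ?_⟩
  · intro e' he'
    obtain ⟨hnp, e, he, hp⟩ := exists_produces_of_mem_support_blowupStep hj (tOf_hyp ∅ 0) hq he'
    have h := hR e he
    rw [produces_x_iff] at hp
    rw [degree_fin5] at hp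
    omega
  · have hb : V (ex + ew + d - 4) 4 0 0 (ew + d) = base 8 0 ∅ (V ex 4 0 0 (ew + d)) := by
      rw [base_x, degree_V]; congr 1; simp; omega
    rw [hb, coeff_base_blowupStep hj (tOf_hyp ∅ 0) hq (by simp; omega) ?_ ?_, prod_tOf_pow, mul_one]
    · simpa using hk1
    · intro e he hp
      have h := hR e he
      rw [← hb, produces_x_iff] at hp
      rw [degree_fin5] at hp
      rw [eq_V_iff]
      simp only [V_apply_zero, V_apply_one, V_apply_two, V_apply_three, V_apply_four] at hp
      omega
    · rw [← hb, isPthPowerExponent_fin5_iff]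
      simp only [V_apply_zero, V_apply_one, V_apply_two, V_apply_three, V_apply_four]
      omega
  · have hb : V (ex + ew + d - 4 + d + 3) 0 0 0 ew = base 8 0 ∅ (V (ex + 2 * d + 7) 0 0 0 ew) := by
      rw [base_x, degree_V]; congr 1; simp; omega
    rw [hb, coeff_base_blowupStep hj (tOf_hyp ∅ 0) hq (by simp; omega) ?_ ?_, prod_tOf_pow, mul_one]
    · simpa using hk2
    · intro e he hp
      have h := hR e he
      rw [← hb, produces_x_iff] at hp
      rw [degree_fin5] at hp
      rw [eq_V_iff]
      simp only [V_apply_zero, V_apply_one, V_apply_two, V_apply_three, V_apply_four] at hp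
      omega
    · rw [← hb, isPthPowerExponent_fin5_iff]
      simp only [V_apply_zero, V_apply_one, V_apply_two, V_apply_three, V_apply_four]
      omega

/-! ## Stages (3), (4): the `u`-chart and the `v`-charts, `S2 → S4(0) → S4(1) → ⋯ → S4(d/2)` -/

/-- Shape during the `v`-blow-ups (4), after `c` of them (stage (3) is `c = 0`, `ev = 0`):
`x^{ex} u^{eu} v^{ev} w^{ew}·(w^d y^4 u v^{2c} B + x^{d+3} A)` (`eu ↔ 8r+7`).
[cite: HauserPerlega2019, §4 First example (3), (4)] -/
def Shape4 (c d ex eu ev ew : ℕ) (F : MvPolynomial (Fin 5) K) : Prop :=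
  (∀ e ∈ F.support, (ex ≤ e 0 ∧ 4 ≤ e 1 ∧ eu + 1 ≤ e 2 ∧ ev + 2 * c ≤ e 3 ∧ ew + d ≤ e 4) ∨
      (ex + d + 3 ≤ e 0 ∧ eu ≤ e 2 ∧ ev ≤ e 3 ∧ ew ≤ e 4)) ∧
  coeff (V ex 4 (eu + 1) (ev + 2 * c) (ew + d)) F ≠ 0 ∧ coeff (V (ex + d + 3) 0 eu ev ew) F ≠ 0

/-- **Blow-up (3)**, `u`-chart: `S2(d, ex, ew) → S4(0, d, ex, ex + ew + d − 5, 0, ew)`.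
[cite: HauserPerlega2019, §4 First example (3)] -/
theorem shape4_of_shape2 {d ex ew : ℕ} (hd : 2 ≤ d) (hd2 : d % 2 = 0)
    (hex8 : ex % 8 = 4) (hew : (ew + d) % 8 = 0) {F : MvPolynomial (Fin 5) K}
    (hF : Shape2 d ex ew F) :
    Shape4 0 d ex (ex + ew + d - 5) 0 ew (blowupStep 8 2 (tOf ∅) F) := by
  obtain ⟨hR, hk1, hk2⟩ := hF
  have hq : ∀ e ∈ F.support, 8 ≤ e.degree := fun e he => by
    have h := hR e he; rw [degree_fin5]; omega
  have hj : (2 : Fin 5) ∉ (∅ : Finset (Fin 5)) := by simp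
  refine ⟨?_, ?_, ?_⟩
  · intro e' he'
    obtain ⟨-, e, he, hp⟩ := exists_produces_of_mem_support_blowupStep hj (tOf_hyp ∅ 2) hq he'
    have h := hR e he
    rw [produces_u_iff, degree_fin5] at hp
    omega
  · have hb : V ex 4 (ex + ew + d - 5 + 1) (0 + 2 * 0) (ew + d) = base 8 2 ∅ (V ex 4 0 0 (ew + d)) := by
      rw [base_u, degree_V, eq_V_iff]; simp; omega
    rw [hb, coeff_base_blowupStep hj (tOf_hyp ∅ 2) hq (by simp; omega) ?_ ?_, prod_tOf_pow, mul_one]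
    · simpa using hk1
    · intro e he hp
      have h := hR e he
      rw [← hb, produces_u_iff, degree_fin5] at hp
      rw [eq_V_iff]
      simp only [V_apply_zero, V_apply_one, V_apply_two, V_apply_three, V_apply_four] at hp
      omega
    · rw [← hb, isPthPowerExponent_fin5_iff]
      simp only [V_apply_zero, V_apply_one, V_apply_two, V_apply_three, V_apply_four]
      omega
  · have hb : V (ex + d + 3) 0 (ex + ew + d - 5) 0 ew = base 8 2 ∅ (V (ex + d + 3) 0 0 0 ew) := by
      rw [base_u, degree_V, eq_V_iff]; simp; omega
    rw [hb, coeff_base_blowupStep hj (tOf_hyp ∅ 2) hq (by simp; omega) ?_ ?_, prod_tOf_pow, mul_one]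
    · simpa using hk2
    · intro e he hp
      have h := hR e he
      rw [← hb, produces_u_iff, degree_fin5] at hp
      rw [eq_V_iff]
      simp only [V_apply_zero, V_apply_one, V_apply_two, V_apply_three, V_apply_four] at hp
      omega
    · rw [← hb, isPthPowerExponent_fin5_iff]
      simp only [V_apply_zero, V_apply_one, V_apply_two, V_apply_three, V_apply_four]
      omega

/-- **Blow-ups (4)**, `v`-chart, one at a time: `S4(c) → S4(c+1)`, the exceptional `v`-exponent
growing by `ex + eu + ew + d − 5` (`↔ 8a + 8r + 8s + 6`). [cite: HauserPerlega2019, §4 First example (4)] -/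
theorem shape4_succ {c d ex eu ev ew : ℕ} (hd : 2 ≤ d) (hd2 : d % 2 = 0)
    (hex8 : ex % 8 = 4) (heu8 : eu % 8 = 7) (hew : (ew + d) % 8 = 0) {F : MvPolynomial (Fin 5) K}
    (hF : Shape4 c d ex eu ev ew F) :
    Shape4 (c + 1) d ex eu (ev + (ex + eu + ew + d - 5)) ew (blowupStep 8 3 (tOf ∅) F) := by
  obtain ⟨hR, hk1, hk2⟩ := hF
  have hq : ∀ e ∈ F.support, 8 ≤ e.degree := fun e he => by
    have h := hR e he; rw [degree_fin5]; omega
  have hj : (3 : Fin 5) ∉ (∅ : Finset (Fin 5)) := by simp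
  refine ⟨?_, ?_, ?_⟩
  · intro e' he'
    obtain ⟨-, e, he, hp⟩ := exists_produces_of_mem_support_blowupStep hj (tOf_hyp ∅ 3) hq he'
    have h := hR e he
    rw [produces_v_iff, degree_fin5] at hp
    omega
  · have hb : V ex 4 (eu + 1) (ev + (ex + eu + ew + d - 5) + 2 * (c + 1)) (ew + d) =
        base 8 3 ∅ (V ex 4 (eu + 1) (ev + 2 * c) (ew + d)) := by
      rw [base_v, degree_V, eq_V_iff]; simp; omega
    rw [hb, coeff_base_blowupStep hj (tOf_hyp ∅ 3) hq (by simp; omega) ?_ ?_, prod_tOf_pow, mul_one]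
    · simpa using hk1
    · intro e he hp
      have h := hR e he
      rw [← hb, produces_v_iff, degree_fin5] at hp
      rw [eq_V_iff]
      simp only [V_apply_zero, V_apply_one, V_apply_two, V_apply_three, V_apply_four] at hp
      omega
    · rw [← hb, isPthPowerExponent_fin5_iff]
      simp only [V_apply_zero, V_apply_one, V_apply_two, V_apply_three, V_apply_four]
      omega
  · have hb : V (ex + d + 3) 0 eu (ev + (ex + eu + ew + d - 5)) ew =
        base 8 3 ∅ (V (ex + d + 3) 0 eu ev ew) := by
      rw [base_v, degree_V, eq_V_iff]; simp; omega
    rw [hb, coeff_base_blowupStep hj (tOf_hyp ∅ 3) hq (by simp; omega) ?_ ?_, prod_tOf_pow, mul_one]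
    · simpa using hk2
    · intro e he hp
      have h := hR e he
      rw [← hb, produces_v_iff, degree_fin5] at hp
      rw [eq_V_iff]
      simp only [V_apply_zero, V_apply_one, V_apply_two, V_apply_three, V_apply_four] at hp
      omega
    · rw [← hb, isPthPowerExponent_fin5_iff]
      simp only [V_apply_zero, V_apply_one, V_apply_two, V_apply_three, V_apply_four]
      omega

/-! ## Stage (5): the `w`-chart with `y ↦ y + 1`, `v ↦ v + 1`, `S4(d/2) → S5` -/

/-- Shape after blow-up (5): `x^{ex} u^{eu} w^{ew}·(w^{d+2} u B + x^{d+3} A)` (`ew ↔ 8s − (d+2)`).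
[cite: HauserPerlega2019, §4 First example (5)] -/
def Shape5 (d ex eu ew : ℕ) (F : MvPolynomial (Fin 5) K) : Prop :=
  (∀ e ∈ F.support, (ex ≤ e 0 ∧ eu + 1 ≤ e 2 ∧ ew + d + 2 ≤ e 4) ∨
      (ex + d + 3 ≤ e 0 ∧ eu ≤ e 2 ∧ ew ≤ e 4)) ∧
  coeff (V ex 0 (eu + 1) 0 (ew + d + 2)) F ≠ 0 ∧ coeff (V (ex + d + 3) 0 eu 0 ew) F ≠ 0

/-- **Blow-up (5)**, `w`-chart, `y ↦ y + 1`, `v ↦ v + 1` (from `S4(c)` with `2c = d`):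
`S4(c, d, ex, eu, ev, ew) → S5(d, ex, eu, ex + eu + ev + ew + d − 5)`; the units
`(y+1)^4 (v+1)^{…}` are absorbed into `B`, `A`. [cite: HauserPerlega2019, §4 First example (5)] -/
theorem shape5_of_shape4 {c d ex eu ev ew : ℕ} (hc : 2 * c = d) (hd : 2 ≤ d)
    (hex8 : ex % 8 = 4) (heu8 : eu % 8 = 7) (hew : (ew + d) % 8 = 0) {F : MvPolynomial (Fin 5) K}
    (hF : Shape4 c d ex eu ev ew F) :
    Shape5 d ex eu (ex + eu + ev + ew + d - 5) (blowupStep 8 4 (tOf {1, 3}) F) := by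
  obtain ⟨hR, hk1, hk2⟩ := hF
  have hq : ∀ e ∈ F.support, 8 ≤ e.degree := fun e he => by
    have h := hR e he; rw [degree_fin5]; omega
  have hj : (4 : Fin 5) ∉ ({1, 3} : Finset (Fin 5)) := by decide
  refine ⟨?_, ?_, ?_⟩
  · intro e' he'
    obtain ⟨-, e, he, hp⟩ := exists_produces_of_mem_support_blowupStep hj (tOf_hyp {1, 3} 4) hq he'
    have h := hR e he
    rw [produces_wyv_iff, degree_fin5] at hp
    omega
  · have hb : V ex 0 (eu + 1) 0 (ex + eu + ev + ew + d - 5 + d + 2) =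
        base 8 4 {1, 3} (V ex 4 (eu + 1) (ev + 2 * c) (ew + d)) := by
      rw [base_wyv, degree_V, eq_V_iff]; simp; omega
    rw [hb, coeff_base_blowupStep hj (tOf_hyp {1, 3} 4) hq (by simp; omega) ?_ ?_, prod_tOf_pow,
      mul_one]
    · simpa using hk1
    · intro e he hp
      have h := hR e he
      rw [← hb, produces_wyv_iff, degree_fin5] at hp
      rw [eq_V_iff]
      simp only [V_apply_zero, V_apply_two, V_apply_four] at hp
      omega
    · rw [← hb, isPthPowerExponent_fin5_iff]
      simp only [V_apply_zero, V_apply_one, V_apply_two, V_apply_three, V_apply_four]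
      omega
  · have hb : V (ex + d + 3) 0 eu 0 (ex + eu + ev + ew + d - 5) =
        base 8 4 {1, 3} (V (ex + d + 3) 0 eu ev ew) := by
      rw [base_wyv, degree_V, eq_V_iff]; simp; omega
    rw [hb, coeff_base_blowupStep hj (tOf_hyp {1, 3} 4) hq (by simp; omega) ?_ ?_, prod_tOf_pow,
      mul_one]
    · simpa using hk2
    · intro e he hp
      have h := hR e he
      rw [← hb, produces_wyv_iff, degree_fin5] at hp
      rw [eq_V_iff]
      simp only [V_apply_zero, V_apply_two, V_apply_four] at hp
      omega
    · rw [← hb, isPthPowerExponent_fin5_iff]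
      simp only [V_apply_zero, V_apply_one, V_apply_two, V_apply_three, V_apply_four]
      omega

/-! ## Stages (6), (7): the `u`-chart and the `y`-charts, `S5 → S7(0) → ⋯ → S7(2d+10)` -/

/-- Shape during the `y`-blow-ups (7), after `c` of them (stage (6) is `c = 0`, `ey = 0`):
`x^{ex} y^{ey} u^{eu} w^{ew}·(w^{d+2}(λ + h) + x^{d+3} y^c A)` with every monomial of `h` divisible by
`u·y^c` — the exact point `λ·M w^{d+2}` plus the orthants of `w^{d+2} y^c u Q` and `x^{d+3} y^c A`
(`eu ↔ 8r + 4`, `ey ↔ 8b`). [cite: HauserPerlega2019, §4 First example (6), (7)] -/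
def Shape7 (c d ex ey eu ew : ℕ) (F : MvPolynomial (Fin 5) K) : Prop :=
  (∀ e ∈ F.support, e = V ex ey eu 0 (ew + d + 2) ∨
      (ex ≤ e 0 ∧ ey + c ≤ e 1 ∧ eu + 1 ≤ e 2 ∧ ew + d + 2 ≤ e 4) ∨
      (ex + d + 3 ≤ e 0 ∧ ey + c ≤ e 1 ∧ eu ≤ e 2 ∧ ew ≤ e 4)) ∧
  coeff (V ex ey eu 0 (ew + d + 2)) F ≠ 0 ∧ coeff (V (ex + d + 3) (ey + c) eu 0 ew) F ≠ 0

/-- **Blow-up (6)**, `u`-chart: `S5(d, ex, eu, ew) → S7(0, d, ex, 0, ex + eu + ew + d − 5, ew)`;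
"`w^{d+2}` becomes the new initial form of `G`", the residual order is `d + 2`.
[cite: HauserPerlega2019, §4 First example (6)] -/
theorem shape7_of_shape5 {d ex eu ew : ℕ} (hd : 2 ≤ d) (hd2 : d % 2 = 0)
    (hex8 : ex % 8 = 4) (heu8 : eu % 8 = 7) (hew : (ew + d + 2) % 8 = 0) {F : MvPolynomial (Fin 5) K}
    (hF : Shape5 d ex eu ew F) :
    Shape7 0 d ex 0 (ex + eu + ew + d - 5) ew (blowupStep 8 2 (tOf ∅) F) := by
  obtain ⟨hR, hk1, hk2⟩ := hF
  have hq : ∀ e ∈ F.support, 8 ≤ e.degree := fun e he => by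
    have h := hR e he; rw [degree_fin5]; omega
  have hj : (2 : Fin 5) ∉ (∅ : Finset (Fin 5)) := by simp
  refine ⟨?_, ?_, ?_⟩
  · intro e' he'
    obtain ⟨-, e, he, hp⟩ := exists_produces_of_mem_support_blowupStep hj (tOf_hyp ∅ 2) hq he'
    have h := hR e he
    rw [produces_u_iff, degree_fin5] at hp
    rw [eq_V_iff]
    omega
  · have hb : V ex 0 (ex + eu + ew + d - 5) 0 (ew + d + 2) =
        base 8 2 ∅ (V ex 0 (eu + 1) 0 (ew + d + 2)) := by
      rw [base_u, degree_V, eq_V_iff]; simp; omega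
    rw [hb, coeff_base_blowupStep hj (tOf_hyp ∅ 2) hq (by simp; omega) ?_ ?_, prod_tOf_pow, mul_one]
    · simpa using hk1
    · intro e he hp
      have h := hR e he
      rw [← hb, produces_u_iff, degree_fin5] at hp
      rw [eq_V_iff]
      simp only [V_apply_zero, V_apply_one, V_apply_two, V_apply_three, V_apply_four] at hp
      omega
    · rw [← hb, isPthPowerExponent_fin5_iff]
      simp only [V_apply_zero, V_apply_one, V_apply_two, V_apply_three, V_apply_four]
      omega
  · have hb : V (ex + d + 3) (0 + 0) (ex + eu + ew + d - 5) 0 ew =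
        base 8 2 ∅ (V (ex + d + 3) 0 eu 0 ew) := by
      rw [base_u, degree_V, eq_V_iff]; simp; omega
    rw [hb, coeff_base_blowupStep hj (tOf_hyp ∅ 2) hq (by simp; omega) ?_ ?_, prod_tOf_pow, mul_one]
    · simpa using hk2
    · intro e he hp
      have h := hR e he
      rw [← hb, produces_u_iff, degree_fin5] at hp
      rw [eq_V_iff]
      simp only [V_apply_zero, V_apply_one, V_apply_two, V_apply_three, V_apply_four] at hp
      omega
    · rw [← hb, isPthPowerExponent_fin5_iff]
      simp only [V_apply_zero, V_apply_one, V_apply_two, V_apply_three, V_apply_four]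
      omega

/-- **Blow-ups (7)**, `y`-chart, one at a time: `S7(c) → S7(c+1)`, the exceptional `y`-exponent
growing by `ex + eu + ew + d − 6` (`↔ 8a + 8r + 8s + 8`), a power of `y` being added to `x^{d+3}`
and to the non-constant part of the unit `B`. [cite: HauserPerlega2019, §4 First example (7)] -/
theorem shape7_succ {c d ex ey eu ew : ℕ} (hd : 2 ≤ d) (hd2 : d % 2 = 0)
    (hex8 : ex % 8 = 4) (hey8 : ey % 8 = 0) (heu8 : eu % 8 = 4) (hew : (ew + d + 2) % 8 = 0)
    {F : MvPolynomial (Fin 5) K} (hF : Shape7 c d ex ey eu ew F) :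
    Shape7 (c + 1) d ex (ey + (ex + eu + ew + d - 6)) eu ew (blowupStep 8 1 (tOf ∅) F) := by
  obtain ⟨hR, hk1, hk2⟩ := hF
  have hq : ∀ e ∈ F.support, 8 ≤ e.degree := fun e he => by
    have h := hR e he; rw [eq_V_iff] at h; rw [degree_fin5]; omega
  have hj : (1 : Fin 5) ∉ (∅ : Finset (Fin 5)) := by simp
  refine ⟨?_, ?_, ?_⟩
  · intro e' he'
    obtain ⟨-, e, he, hp⟩ := exists_produces_of_mem_support_blowupStep hj (tOf_hyp ∅ 1) hq he'
    have h := hR e he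
    rw [produces_y_iff, degree_fin5] at hp
    rw [eq_V_iff] at h ⊢
    omega
  · have hb : V ex (ey + (ex + eu + ew + d - 6)) eu 0 (ew + d + 2) =
        base 8 1 ∅ (V ex ey eu 0 (ew + d + 2)) := by
      rw [base_y, degree_V, eq_V_iff]; simp; omega
    rw [hb, coeff_base_blowupStep hj (tOf_hyp ∅ 1) hq (by simp; omega) ?_ ?_, prod_tOf_pow, mul_one]
    · simpa using hk1
    · intro e he hp
      have h := hR e he
      rw [← hb, produces_y_iff, degree_fin5] at hp
      rw [eq_V_iff] at h ⊢
      simp only [V_apply_zero, V_apply_one, V_apply_two, V_apply_three, V_apply_four] at hp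
      omega
    · rw [← hb, isPthPowerExponent_fin5_iff]
      simp only [V_apply_zero, V_apply_one, V_apply_two, V_apply_three, V_apply_four]
      omega
  · have hb : V (ex + d + 3) (ey + (ex + eu + ew + d - 6) + (c + 1)) eu 0 ew =
        base 8 1 ∅ (V (ex + d + 3) (ey + c) eu 0 ew) := by
      rw [base_y, degree_V, eq_V_iff]; simp; omega
    rw [hb, coeff_base_blowupStep hj (tOf_hyp ∅ 1) hq (by simp; omega) ?_ ?_, prod_tOf_pow, mul_one]
    · simpa using hk2
    · intro e he hp
      have h := hR e he
      rw [← hb, produces_y_iff, degree_fin5] at hp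
      rw [eq_V_iff] at h ⊢
      simp only [V_apply_zero, V_apply_one, V_apply_two, V_apply_three, V_apply_four] at hp
      omega
    · rw [← hb, isPthPowerExponent_fin5_iff]
      simp only [V_apply_zero, V_apply_one, V_apply_two, V_apply_three, V_apply_four]
      omega

/-! ## Stage (1): the `x`-chart with `y ↦ y + 1`, `u ↦ u + 1`, and the cleaning, `S0 → S1` -/

/-- Shape (0), the starting equation of a cycle:
`x^{ex} y^{ey} u^{eu} w^{ew}·(w^d(λ + u^{2d+6} Q) + x^{d+1} u^{2d+6} A)` (`ex ↔ 8a+4`, `ey ↔ 8b+4`,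
`eu ↔ 8r`, `ew ↔ 8s − d`): the exact point `λ·M w^d` and the orthants of `w^d u^{2d+6} Q` and
`x^{d+1} u^{2d+6} A`. [cite: HauserPerlega2019, §4 First example (0)] -/
def Shape0 (d ex ey eu ew : ℕ) (F : MvPolynomial (Fin 5) K) : Prop :=
  (∀ e ∈ F.support, e = V ex ey eu 0 (ew + d) ∨
      (ex ≤ e 0 ∧ ey ≤ e 1 ∧ eu + 2 * d + 6 ≤ e 2 ∧ ew + d ≤ e 4) ∨
      (ex + d + 1 ≤ e 0 ∧ ey ≤ e 1 ∧ eu + 2 * d + 6 ≤ e 2 ∧ ew ≤ e 4)) ∧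
  coeff (V ex ey eu 0 (ew + d)) F ≠ 0 ∧ coeff (V (ex + d + 1) ey (eu + 2 * d + 6) 0 ew) F ≠ 0

/-- **The `λ`-term under blow-up (1)** (characteristic `2`): the transform of
`λ · x^a y^b u^c w^{w}` with `b ≡ 4`, `c ≡ 0 (mod 8)` in the `x`-chart with `y ↦ y+1`, `u ↦ u+1` is
`λ x^{a+b+c+w−8} w^{w} (y+1)^b (u+1)^c = λ x^{…} w^{w} (y^8+1)^{b/8}(u^8+1)^{c/8}·(y^4 + 1)`; when
`x^{a+b+c+w−8} w^w` is an `8`-th power, cleaning deletes `λ x^{…}w^{w}(y^8+1)^{b/8}(u^8+1)^{c/8}`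
("`λ (u+1)^{8r} w^d`" in the source) and keeps its product with `y^4` ("`w^d y^4·B`"): all surviving
monomials have `y`-exponent `≡ 4`, `u`-exponent `≡ 0 (mod 8)`, and `y^4 x^{…} w^{w}` has coefficient
`λ`. [cite: HauserPerlega2019, §4 First example (1)] -/
theorem blowupStep_monomial_pt [CharP K 2] {a b c w : ℕ} (hb : b % 8 = 4) (hc : c % 8 = 0)
    (hsum : (a + b + c + w) % 8 = 0) (hw : w % 8 = 0) (h8 : 8 ≤ a + b + c + w) (cc : K) :
    (∀ e' ∈ (blowupStep 8 0 (tOf {1, 2}) (monomial (V a b c 0 w) cc)).support,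
        e' 0 = a + b + c + w - 8 ∧ e' 1 % 8 = 4 ∧ e' 2 % 8 = 0 ∧ e' 3 = 0 ∧ e' 4 = w) ∧
      coeff (V (a + b + c + w - 8) 4 0 0 w) (blowupStep 8 0 (tOf {1, 2}) (monomial (V a b c 0 w) cc))
        = cc := by
  have hj : (0 : Fin 5) ∉ ({1, 2} : Finset (Fin 5)) := by decide
  have hdeg : 8 ≤ (V a b c 0 w).degree := by simp; omega
  have hbase : base 8 0 {1, 2} (V a b c 0 w) = V (a + b + c + w - 8) 0 0 0 w := by
    rw [base_xyu, degree_V, eq_V_iff]; simp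
  set P8 : MvPolynomial (Fin 5) K := (X 1 ^ 8 + C 1) ^ (b / 8) * (X 2 ^ 8 + C 1) ^ (c / 8) with hP8
  have hP8q : IsQthPowerSupported 8 P8 :=
    (isQthPowerSupported_X_pow_add_C_pow 8 1 1 _).mul (isQthPowerSupported_X_pow_add_C_pow 8 2 1 _)
  have hP8vars : P8.vars ⊆ {1, 2} := by
    refine (vars_mul _ _).trans (Finset.union_subset ?_ ?_)
    · exact (vars_pow _ _).trans ((vars_X_pow_add_C_subset 1 8 1).trans (by decide))
    · exact (vars_pow _ _).trans ((vars_X_pow_add_C_subset 2 8 1).trans (by decide))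
  have hP8const : constantCoeff P8 = 1 := by
    rw [hP8]; simp [constantCoeff_X]
  have hchar : CharP (MvPolynomial (Fin 5) K) 2 := inferInstance
  have htF : transFactor {1, 2} (tOf {1, 2}) (V a b c 0 w) = P8 * X 1 ^ 4 + P8 := by
    have h1 : ((X 1 : MvPolynomial (Fin 5) K) + C 1) ^ b = (X 1 ^ 8 + C 1) ^ (b / 8) * (X 1 ^ 4 + 1) := by
      conv_lhs => rw [show b = 2 ^ 3 * (b / 8) + 2 ^ 2 by omega]
      rw [pow_add, X_add_C_pow_mul, one_pow, add_pow_char_pow, ← map_pow, one_pow, C_1]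
      norm_num
    have h2 : ((X 2 : MvPolynomial (Fin 5) K) + C 1) ^ c = (X 2 ^ 8 + C 1) ^ (c / 8) := by
      conv_lhs => rw [show c = 2 ^ 3 * (c / 8) by omega]
      rw [X_add_C_pow_mul, one_pow]
      norm_num
    unfold transFactor
    rw [Finset.prod_pair (by decide : (1 : Fin 5) ≠ 2)]
    simp only [tOf, Finset.mem_insert, Finset.mem_singleton, true_or, or_true, if_true,
      V_apply_one, V_apply_two]
    rw [h1, h2, hP8]
    ring
  have hQ : IsQthPowerSupported 8 (monomial (base 8 0 {1, 2} (V a b c 0 w)) cc * P8) := by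
    refine (isQthPowerSupported_monomial ?_ cc).mul hP8q
    rw [hbase, isPthPowerExponent_fin5_iff]
    simp only [V_apply_zero, V_apply_one, V_apply_two, V_apply_three, V_apply_four]
    omega
  have hs : ¬ IsPthPowerExponent 8 (Finsupp.single (1 : Fin 5) 4) := by
    rw [isPthPowerExponent_iff]; intro h; have := h 1; simp at this
  have hstep : blowupStep 8 0 (tOf {1, 2}) (monomial (V a b c 0 w) cc) =
      monomial (V (a + b + c + w - 8) 0 0 0 w) cc * (P8 * monomial (Finsupp.single 1 4) 1) := by
    rw [blowupStep, transformResidual_monomial hj (tOf_hyp {1, 2} 0) hdeg, htF, mul_add, ← mul_assoc,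
      deletePthPowers_add, hQ.deletePthPowers_eq_zero, add_zero, X_pow_eq_monomial,
      hQ.deletePthPowers_mul_monomial hs 1, hbase, mul_assoc]
  rw [hstep]
  constructor
  · intro e' he'
    rw [MvPolynomial.mem_support_iff, coeff_monomial_mul'] at he'
    split_ifs at he' with hle
    · have hmem : e' - V (a + b + c + w - 8) 0 0 0 w ∈ (P8 * monomial (Finsupp.single 1 4) 1).support := by
        rw [MvPolynomial.mem_support_iff]; intro h0; exact he' (by rw [h0, mul_zero])
      obtain ⟨q8, hq8, hq8eq⟩ := exists_add_of_mem_support_mul_monomial hmem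
      have hq8pow := (isPthPowerExponent_fin5_iff 8 q8).mp (hP8q q8 hq8)
      have hq80 : q8 0 = 0 := apply_eq_zero_of_not_mem_vars hq8 (fun h => by
        have := hP8vars h; simp at this)
      have hq83 : q8 3 = 0 := apply_eq_zero_of_not_mem_vars hq8 (fun h => by
        have := hP8vars h; simp at this)
      have hq84 : q8 4 = 0 := apply_eq_zero_of_not_mem_vars hq8 (fun h => by
        have := hP8vars h; simp at this)
      rw [V_le_iff] at hle
      have e0 := DFunLike.congr_fun hq8eq 0
      have e1 := DFunLike.congr_fun hq8eq 1
      have e2 := DFunLike.congr_fun hq8eq 2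
      have e3 := DFunLike.congr_fun hq8eq 3
      have e4 := DFunLike.congr_fun hq8eq 4
      simp only [Finsupp.tsub_apply, Finsupp.add_apply, V_apply_zero, V_apply_one, V_apply_two,
        V_apply_three, V_apply_four, Finsupp.single_apply] at e0 e1 e2 e3 e4
      simp at e0 e1 e2 e3 e4
      omega
    · exact absurd rfl he'
  · have hV : V (a + b + c + w - 8) 4 0 0 w = V (a + b + c + w - 8) 0 0 0 w + Finsupp.single 1 4 := by
      rw [Finsupp.ext_iff, forall_fin5]; simp
    rw [hV, coeff_monomial_mul, coeff_mul_monomial', if_pos le_rfl, tsub_self, mul_one,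
      ← constantCoeff_eq, hP8const, mul_one]

/-- **Blow-up (1)**, `x`-chart with `y ↦ y + 1`, `u ↦ u + 1`, followed by the cleaning
`z₁ = z − μ x^{a} w^{s}(y+1)^{b}(u+1)^{r}` (`μ⁸ = λ`): `S0(d, ex, ey, eu, ew) → S1(d, ex+ey+eu+ew+d−8, ew)`;
"the residual order has increased to `d + 4`". Valid over every commutative ring of
characteristic `2`. [cite: HauserPerlega2019, §4 First example (1)] -/
theorem shape1_of_shape0 [CharP K 2] {d ex ey eu ew : ℕ} (hd : 2 ≤ d) (hd2 : d % 2 = 0)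
    (hex8 : ex % 8 = 4) (hey8 : ey % 8 = 4) (heu8 : eu % 8 = 0) (hew : (ew + d) % 8 = 0)
    {F : MvPolynomial (Fin 5) K} (hF : Shape0 d ex ey eu ew F) :
    Shape1 d (ex + ey + eu + ew + d - 8) ew (blowupStep 8 0 (tOf {1, 2}) F) := by
  obtain ⟨hR, hk1, hk2⟩ := hF
  have hj : (0 : Fin 5) ∉ ({1, 2} : Finset (Fin 5)) := by decide
  set p₀ : Fin 5 →₀ ℕ := V ex ey eu 0 (ew + d) with hp₀
  set c₀ : K := coeff p₀ F with hc₀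
  set F' : MvPolynomial (Fin 5) K := F - monomial p₀ c₀ with hF'
  have hcoeffF' : ∀ e, coeff e F' = if e = p₀ then 0 else coeff e F := by
    intro e
    rw [hF', coeff_sub, coeff_monomial]
    by_cases h : e = p₀
    · subst h; simp [hc₀]
    · rw [if_neg (Ne.symm h), if_neg h, sub_zero]
  have hsuppF' : ∀ e ∈ F'.support, e ≠ p₀ ∧ e ∈ F.support := by
    intro e he
    rw [MvPolynomial.mem_support_iff, hcoeffF'] at he
    split_ifs at he with h
    · exact absurd rfl he
    · exact ⟨h, MvPolynomial.mem_support_iff.mpr he⟩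
  have hR' : ∀ e ∈ F'.support, (ex ≤ e 0 ∧ ey ≤ e 1 ∧ eu + 2 * d + 6 ≤ e 2 ∧ ew + d ≤ e 4) ∨
      (ex + d + 1 ≤ e 0 ∧ ey ≤ e 1 ∧ eu + 2 * d + 6 ≤ e 2 ∧ ew ≤ e 4) := by
    intro e he
    obtain ⟨hne, heF⟩ := hsuppF' e he
    rcases hR e heF with h | h | h
    · exact absurd h hne
    · exact Or.inl h
    · exact Or.inr h
  have hq' : ∀ e ∈ F'.support, 8 ≤ e.degree := fun e he => by
    have h := hR' e he; rw [degree_fin5]; omega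
  have hdecomp : F = F' + monomial p₀ c₀ := by rw [hF', sub_add_cancel]
  obtain ⟨hxs, hxc⟩ := blowupStep_monomial_pt (K := K) (a := ex) (w := ew + d) hey8 heu8
    (by omega) hew (by omega) c₀
  rw [hdecomp, blowupStep_add]
  refine ⟨?_, ?_, ?_⟩
  · intro e' he'
    rcases Finset.mem_union.mp (support_add he') with h | h
    · obtain ⟨-, e, he, hp⟩ := exists_produces_of_mem_support_blowupStep hj (tOf_hyp {1, 2} 0) hq' h
      have hh := hR' e he
      rw [produces_xyu_iff, degree_fin5] at hp
      omega
    · have := hxs e' h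
      omega
  · have hV : V (ex + ey + eu + ew + d - 8) 4 0 0 (ew + d) = V (ex + ey + eu + (ew + d) - 8) 4 0 0 (ew + d) := by
      rw [eq_V_iff]; simp; omega
    rw [coeff_add, coeff_blowupStep_eq_zero hj (tOf_hyp {1, 2} 0) hq', zero_add, hV, hxc]
    · exact hk1
    · intro e he hp
      have hh := hR' e he
      rw [produces_xyu_iff, degree_fin5] at hp
      simp only [V_apply_zero, V_apply_three, V_apply_four] at hp
      omega
  · have hb : V (ex + ey + eu + ew + d - 8 + 2 * d + 7) 0 0 0 ew =
        base 8 0 {1, 2} (V (ex + d + 1) ey (eu + 2 * d + 6) 0 ew) := by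
      rw [base_xyu, degree_V, eq_V_iff]; simp; omega
    rw [coeff_add, hb, coeff_base_blowupStep hj (tOf_hyp {1, 2} 0) hq' (by simp; omega) ?_ ?_,
      prod_tOf_pow, mul_one]
    · have h0 : coeff (base 8 0 {1, 2} (V (ex + d + 1) ey (eu + 2 * d + 6) 0 ew))
          (blowupStep 8 0 (tOf {1, 2}) (monomial p₀ c₀)) = 0 := by
        by_contra hne
        have := hxs _ (MvPolynomial.mem_support_iff.mpr hne)
        rw [← hb] at this
        simp only [V_apply_zero, V_apply_one, V_apply_two, V_apply_three, V_apply_four] at this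
        omega
      rw [h0, add_zero, hcoeffF', if_neg]
      · exact hk2
      · intro h
        rw [hp₀, eq_V_iff] at h
        simp only [V_apply_zero, V_apply_one, V_apply_two, V_apply_three, V_apply_four] at h
        omega
    · intro e he hp
      have hh := hR' e he
      rw [← hb, produces_xyu_iff, degree_fin5] at hp
      rw [eq_V_iff]
      simp only [V_apply_zero, V_apply_three, V_apply_four] at hp
      omega
    · rw [← hb, isPthPowerExponent_fin5_iff]
      simp only [V_apply_zero, V_apply_one, V_apply_two, V_apply_three, V_apply_four]
      omega

/-! ## Closing the cycle: `S7(2d+10)` is `S0(d+2)` with `y` and `u` exchanged -/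

/-- Coordinates after exchanging `y` and `u`. [folklore] -/
theorem mapDomain_swap (e : Fin 5 →₀ ℕ) :
    e.mapDomain (Equiv.swap (1 : Fin 5) 2) = V (e 0) (e 2) (e 1) (e 3) (e 4) := by
  rw [eq_V_iff]
  simp only [Finsupp.mapDomain_equiv_apply, Equiv.symm_swap]
  refine ⟨?_, ?_, ?_, ?_, ?_⟩ <;> congr 1

/-- **End of the cycle**: "At this point, `f` has again the same form as the starting equation
(exchanging `y` with `u` and `b` with `r`), with the exception of `d` being raised to `d + 2`":
`S7(2d+10, d, ex, ey, eu, ew)(F) → S0(d+2, ex, eu, ey, ew)(F with y ↔ u)`.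
[cite: HauserPerlega2019, §4 First example (7)] -/
theorem shape0_rename_of_shape7 {d ex ey eu ew : ℕ} {F : MvPolynomial (Fin 5) K}
    (hF : Shape7 (2 * d + 10) d ex ey eu ew F) :
    Shape0 (d + 2) ex eu ey ew (rename (Equiv.swap (1 : Fin 5) 2) F) := by
  obtain ⟨hR, hk1, hk2⟩ := hF
  refine ⟨?_, ?_, ?_⟩
  · intro e he
    rw [mem_support_rename_equiv, Equiv.symm_swap, mapDomain_swap] at he
    have h := hR _ he
    rw [eq_V_iff] at h
    simp only [V_apply_zero, V_apply_one, V_apply_two, V_apply_three, V_apply_four] at h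
    rw [eq_V_iff]
    omega
  · rw [coeff_rename_equiv, Equiv.symm_swap, mapDomain_swap]
    simpa [show ew + (d + 2) = ew + d + 2 by omega] using hk1
  · rw [coeff_rename_equiv, Equiv.symm_swap, mapDomain_swap]
    have hV : V (ex + (d + 2) + 1) eu (ey + 2 * (d + 2) + 6) 0 ew = V (ex + d + 3) eu (ey + (2 * d + 10)) 0 ew := by
      rw [eq_V_iff]; simp; omega
    simpa [hV] using hk2

end Stages

end HauserPerlega

end Literature.Barriers.ResolutionOfSingularities
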